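import Summits.HodgeConjecture.HodgeConjecture.Theorems.Ring2AbelianAllAndrePrimitiveLiftLefschetzDegree
import Summits.HodgeConjecture.HodgeConjecture.Theorems.Ring2AbelianAllAndrePrimitiveLiftRows
import HarnessLib

/-!
# Ring 2 · sub-cell AbelianAll (ALL ABELIAN VARIETIES), André axis, part XXIII-e — RANK-ONE INVARIANTS BELOW THE MIDDLE: on a
# compact pencil of abelian `2n`-folds whose invariant classes below the middle degree are the powers of the polarisation, the
# WHOLE André-axis lift at any point costs ONE clause, `L_K : Nⁿ(𝒳) → N^{n+1}(𝒳)` onto on the `(2n+1)`-fold total space; the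
# `E`-power rows `PrimE[2n]` and R∞ (`WeilClassesImaginaryQuadratic`) from it

HONEST FRAMING (page 1, verbatim): **research route, not a corollary; conditional on HC_CM plus one named
minimal statement.** Cell line: research route conditional on HC_CM; not a corollary; Q11.4-sentence-2
already refuted in dim ≥ 3. Nothing in this file proves a case of the Hodge conjecture for an abelian variety; `HC_CM` does not
occur in this file (it is IDLE on the `E`-power rows); item `Theses.RankFourFaces.CMToAbelian` (stmt-16267) OPEN and not closed
here; the habitats `CMPowerAnchoredCompactWeilPencilsAt n` (part IX) are OPEN nodes used as hypotheses. Seat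
`pub-hodge-ring2-ab-andre-2`, gen 15; brief (iii) "smallest open instance stated as a find-the-cycle problem; partial results as
theorems".

## What is proved (theorems only; no definition — `PrimE'[d]`, `NumE'[d,p,q]` are the display-only notations of parts XXI-b /
XIX-f restated verbatim —, no named fact, no sorry)

* **`primitiveLift_of_finrank_range_eq_one`** — (Prim)_t(r) is VACUOUS whenever the invariant classes of degree `2r` form a line
  (`1 ≤ r`; part XXI-e had `r = 2`): the line is `ℂ κ_tʳ`, which is coprimitive.
* **`forall_comap_le_sup_of_rankOne_below_of_lefschetzDegree_middle`** — `d = 2n`, rank-one invariants in the degrees `2r`,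
  `2 ≤ r < n`, at `t`: the lift in EVERY degree at `t` ⟸ `L_K : Nⁿ(𝒳) → N^{n+1}(𝒳)` onto (`K = D.Hη` the rational hyperplane
  class; part XXIII-c for `r = n`, `m = 0`, the lower degrees being free). For `n = 2` the rank hypothesis is empty: on EVERY
  compact pencil of abelian fourfolds, at every point, the André-axis lift ⟸ `L_K : N²(𝒳⁵) → N³(𝒳⁵)` onto (ab-andre-1's
  `standardACompactPencilsAtRelDim_four_iff_surjOn` isolated the same clause as the whole of `A(𝒳⁵, K)`; here it acts pointwise
  and without conjecture `D`).
* **`primitiveLiftE_of_rankOne_below_of_lefschetzDegree_middle`** (`PrimE[2n]` from the clause at the `E`-power points) and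
  **`weilClassesImaginaryQuadratic_of_cmPowerWeilPencils_of_rankOne_below_of_lefschetzDegree_middle`** (R∞: the Weil classes of
  ALL imaginary-quadratic Weil-type abelian varieties from the habitats `(W_E)ₙ` and, pencil by pencil, ONE surjectivity clause
  on the middle-codimension algebraic classes of the total spaces; `HC_CM` idle; K).

HONEST ACCOUNTING (RING2-MAP §AbelianAll gen 15): 0 nodes, 0 facts; the rows are K with the habitat and the clause as displayed
hypotheses; nothing is closed. The W₆/R∞ find-the-cycle problem of AA2.52/AA2.102/AA2.107 now reads: on the `(2n+1)`-fold total
space of a compact Weil-type pencil with large monodromy, show that every codimension-`(n+1)` algebraic class is homologically the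
hyperplane class times a codimension-`n` algebraic class.

References: Grothendieck1968 (§3 p. 196); vanGeemen1994HodgeAV (Thm. 4.3, 5.12, 6.12); Andre1996Motifs (§6.3, Lemme 6.3.3);
VoisinHodgeI2002 (§6.2.3 Cor. 6.26); Kleiman1968AlgebraicCycles (§3); Lieberman1968 (Thm. 1).
-/

noncomputable section

set_option linter.dupNamespace false

namespace Summit.HodgeConjecture.HodgeConjecture.Ring2.AbelianAll

open CategoryTheory AlgebraicGeometry
open Literature.AlgebraicGeometry Literature.AlgebraicGeometry.Motives
open Literature.AlgebraicGeometry.HodgeTheory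
open Literature.AlgebraicTopology.SingularHomology (singularCohomology cupProduct cupProduct_map)
open Literature.Geometry.Kaehler (lefschetzOperator lefschetzPow HasHardLefschetzProperty)

/-! ## §9 Rank-one invariants below the middle: the whole lift from the SINGLE middle clause `A_n(𝒳^{2n+1}, K)` -/

section Middle

open Literature.AlgebraicGeometry.Deligne1982 (cmLocus)
open Summit.HodgeConjecture.HodgeConjecture.Theses
open Summit.HodgeConjecture.HodgeConjecture.Ring2.Hypotheses (cmPowerLocus)
open Summit.HodgeConjecture.HodgeConjecture.WeilTypeLadder (WeilClassesImaginaryQuadratic)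

variable {𝒳 S : SchemeOver ℂ} {d : ℕ} {f : 𝒳 ⟶ S}

/-- **(Prim)_t(r) is VACUOUS when the invariant classes of degree `2r` form a line** (`1 ≤ r ≤ d`; part XXI-e had `r = 2`): the
line is spanned by `κ_tʳ = j_t^*(L_Kʳ 1) ≠ 0`, which lies in the Lefschetz summand `Lʳ P⁰`, so a `κ`-primitive invariant class of
degree `2r` has vanishing top primitive part, i.e. vanishes. [cite: VoisinHodgeI2002, §6.2.3 Cor. 6.26] [cite: vanGeemen1994HodgeAV, Thm. 6.12] -/
theorem primitiveLift_of_finrank_range_eq_one (hf : IsCompactAbelianPencil f d) (t : ComplexPoints S) {K : complexBetti 𝒳 2}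
    (hK : ∀ s : ComplexPoints S, HasHardLefschetzProperty (complexBetti.map (fiberι f s) 2 K) d) {r : ℕ} (hr : 1 ≤ r)
    (h1 : Module.finrank ℂ (LinearMap.range (complexBetti.map (fiberι f t) (2 * r)).hom) = 1) :
    ∀ ξ ∈ algebraicClasses (fiberOver f t) r,
      ξ ∈ primitiveClasses (complexBetti.map (fiberι f t) 2 K) d (2 * r) →
      ξ ∈ LinearMap.range (complexBetti.map (fiberι f t) (2 * r)).hom →
      ξ ∈ (algebraicClasses 𝒳 r).map (complexBetti.map (fiberι f t) (2 * r)).hom := by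
  intro ξ _ hprim hrange
  suffices h0 : ξ = 0 by rw [h0]; exact Submodule.zero_mem _
  set κ := complexBetti.map (fiberι f t) 2 K with hκdef
  rcases lt_or_ge d (2 * r) with hd | hd
  · rw [primitiveClasses_eq_bot_of_lt κ d hd, Submodule.mem_bot] at hprim
    exact hprim
  have h00 : 0 + 2 * r = 2 * r := by omega
  set v := complexBetti.map (fiberι f t) (2 * r)
    (lefschetzPowTo K r 0 (2 * r) h00 (singularCohomology.one ℂ (ComplexPoints 𝒳))) with hvdef
  have hv0 : v ≠ 0 := map_fiberι_lefschetzPowTo_one_ne_zero_of_le hf hK (by omega) h00 t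
  have hvr : v ∈ LinearMap.range (complexBetti.map (fiberι f t) (2 * r)).hom := ⟨_, rfl⟩
  obtain ⟨c, hc⟩ : ∃ c : ℂ, c • v = ξ := by
    have hne : (⟨v, hvr⟩ : LinearMap.range (complexBetti.map (fiberι f t) (2 * r)).hom) ≠ 0 := fun h ↦
      hv0 (congrArg Subtype.val h)
    obtain ⟨c, hc⟩ := (finrank_eq_one_iff_of_nonzero' _ hne).1 h1 ⟨ξ, hrange⟩
    exact ⟨c, congrArg Subtype.val hc⟩
  have hone : complexBetti.map (fiberι f t) 0 (singularCohomology.one ℂ (ComplexPoints 𝒳)) ∈ primitiveClasses κ d 0 := by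
    rw [primitiveClasses_eq_ker κ d (by omega) (show 0 + (d + 1) = d + 1 by omega)
      (show 0 + 2 * (d + 1) = 2 * d + 2 by ring), LinearMap.mem_ker]
    haveI := hvan_fiberOver hf t (2 * d + 2) (by omega)
    exact Subsingleton.elim _ _
  have hvmem : v ∈ lefschetzSummand κ d (2 * r) ⟨(0, r), h00⟩ := by
    rw [hvdef, map_fiberι_lefschetzPowTo t K r 0 (2 * r) h00]
    exact lefschetzPowTo_mem_lefschetzSummand h00 hone
  have hξmem : ξ ∈ lefschetzSummand κ d (2 * r) ⟨(0, r), h00⟩ := by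
    rw [← hc]; exact Submodule.smul_mem _ c hvmem
  have h40 : 2 * r + 2 * 0 = 2 * r := by omega
  have hne : (⟨(0, r), h00⟩ : {P : ℕ × ℕ // P.1 + 2 * P.2 = 2 * r}) ≠ ⟨(2 * r, 0), h40⟩ := by
    intro h; have := congrArg (fun P ↦ P.1.2) h; simp only at this; omega
  have hzero := primitivePart_eq_zero_of_mem_ne (hK t) (hvan_fiberOver hf t) hne hξmem
  have hself := primitivePart_lefschetzPowTo_of_mem (hK t) (hvan_fiberOver hf t) ⟨(2 * r, 0), h40⟩
    (show 2 * r + 0 ≤ d by omega) hprim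
  rw [lefschetzPowTo_zero_eq_id κ, LinearMap.id_apply] at hself
  rw [← hself]
  exact hzero

/-- **RANK-ONE INVARIANTS BELOW THE MIDDLE: THE WHOLE LIFT AT `t` FROM THE SINGLE MIDDLE CLAUSE `A_n(𝒳, K)`** — on a compact pencil
of abelian `2n`-folds whose invariant classes in every degree `2r`, `2 ≤ r < n`, form a line (e.g. the Weil-type pencils with
monodromy dense in `SU(n,n)`: invariants `ℂκʳ` below the middle, `ℂκⁿ ⊕ (W_K ⊗ ℂ)` in the middle), the André-axis lift in every
degree at ANY point `t` follows from `L_K : Nⁿ(𝒳) → N^{n+1}(𝒳)` ONTO on the `(2n+1)`-fold total space (`K` the rational hyperplane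
class of a Kähler–rational datum). For `n = 2` the rank hypothesis is EMPTY: on every compact pencil of abelian fourfolds the lift
at every point follows from `L_K : N²(𝒳⁵) → N³(𝒳⁵)` onto. No `HC_CM`, no named fact. [cite: Grothendieck1968, §3 p. 196 (A(X))]
[cite: vanGeemen1994HodgeAV, Thm. 6.12] [cite: Andre1996Motifs, §6.3 (p. 33)] -/
theorem forall_comap_le_sup_of_rankOne_below_of_lefschetzDegree_middle {n : ℕ} {f : 𝒳 ⟶ S}
    (hf : IsCompactAbelianPencil f (2 * n)) (t : ComplexPoints S) (D : KaehlerRationalDatum (2 * n + 1) 𝒳)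
    (hK : ∀ s : ComplexPoints S, HasHardLefschetzProperty (complexBetti.map (fiberι f s) 2 D.Hη) (2 * n))
    (hKt : IsPolarizationClass (2 * n) (fiberOver f t) (complexBetti.map (fiberι f t) 2 D.Hη))
    (hrank : ∀ r, 2 ≤ r → r < n → Module.finrank ℂ (LinearMap.range (complexBetti.map (fiberι f t) (2 * r)).hom) = 1)
    (hA : ∀ y ∈ algebraicClasses 𝒳 (n + 1), ∃ x ∈ algebraicClasses 𝒳 n,
      lefschetzPowTo D.Hη 1 (2 * n) (2 * (n + 1)) (by omega) x = y) :
    ∀ p : ℕ, (algebraicClasses (fiberOver f t) p).comap (complexBetti.map (fiberι f t) (2 * p)).hom ≤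
      algebraicClasses 𝒳 p ⊔ LinearMap.ker (complexBetti.map (fiberι f t) (2 * p)).hom := by
  have hKalg : D.Hη ∈ algebraicClasses 𝒳 1 := (isPolarizationClass_Hη hf.isSmoothProjective_total D).mem_algebraicClasses
  have hAt := standardConjectureA_fiberOver hf t hKt
  have hAcl : ∀ p : ℕ, ∀ (p' r' q' : ℕ), p' < p → 2 * p' + 1 ≤ 2 * n → 2 * p' + r' = 2 * n → p' + r' = q' →
      Set.SurjOn (lefschetzPow (complexBetti.map (fiberι f t) 2 D.Hη) r' (2 * p'))
        (algebraicClasses (fiberOver f t) p' : Set (complexBetti (fiberOver f t) (2 * p')))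
        (supportedClasses (fiberOver f t) (2 * p' + 2 * r') q') :=
    fun p p' r' q' _ _ h1 h2 ↦ (hAt.2 p' r' q' h1 h2).surjOn
  -- below the middle the primitive lifts are vacuous
  have hlow : ∀ p, p < n → (algebraicClasses (fiberOver f t) p).comap (complexBetti.map (fiberι f t) (2 * p)).hom ≤
      algebraicClasses 𝒳 p ⊔ LinearMap.ker (complexBetti.map (fiberι f t) (2 * p)).hom :=
    fun p hp ↦ comap_le_sup_of_primitiveLift hf t hKalg hK hKt p (hAcl p)
      fun r h2r hrp _ ↦ primitiveLift_of_finrank_range_eq_one hf t hK (by omega) (hrank r h2r (by omega))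
  intro p
  refine comap_le_sup_of_primitiveLift hf t hKalg hK hKt p (hAcl p) fun r h2r hrp hrd ↦ ?_
  rcases Nat.lt_or_ge r n with hrn | hrn
  · exact primitiveLift_of_finrank_range_eq_one hf t hK (by omega) (hrank r h2r hrn)
  · obtain rfl : r = n := by omega
    obtain ⟨p', hp'⟩ : ∃ p', r = p' + 1 := ⟨r - 1, by omega⟩
    subst hp'
    exact primitiveLift_succ_of_lefschetzDegree' hf t D hK hKt (m := 0) (by omega) (hlow p' (by omega))
      (fun y hy ↦ hA y hy)

/-- `PrimE[d]` VERBATIM as in parts XXI-b/XXII-d (display-only local notation, not a definition). -/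
local notation3 (prettyPrint := false) "PrimE'[" d "]" =>
  ∀ ⦃𝒳 S : SchemeOver ℂ⦄ (f : 𝒳 ⟶ S) (_ : IsCompactAbelianPencil f d) (t : ComplexPoints S),
    t ∈ cmPowerLocus f d → ∀ (K : complexBetti 𝒳 2), K ∈ algebraicClasses 𝒳 1 →
    (∀ s : ComplexPoints S, IsPolarizationClass d (fiberOver f s) (complexBetti.map (fiberι f s) 2 K)) →
    ∀ r, 2 ≤ r → 2 * r ≤ d → ∀ ξ ∈ algebraicClasses (fiberOver f t) r,
      ξ ∈ primitiveClasses (complexBetti.map (fiberι f t) 2 K) d (2 * r) →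
      ξ ∈ LinearMap.range (complexBetti.map (fiberι f t) (2 * r)).hom →
      ξ ∈ (algebraicClasses 𝒳 r).map (complexBetti.map (fiberι f t) (2 * r)).hom

/-- `NumE[d, p, q]` VERBATIM as in part XIX-f (display-only local notation, not a definition). -/
local notation3 (prettyPrint := false) "NumE'[" d ", " p ", " q "]" =>
  ∀ ⦃𝒳 S : SchemeOver ℂ⦄ (f : 𝒳 ⟶ S) (hf : IsCompactAbelianPencil f d) (t : ComplexPoints S),
    t ∈ cmPowerLocus f d → ∀ (hpq : p + q = d), ∀ b ∈ algebraicClasses (fiberOver f t) q,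
      (∀ a ∈ algebraicClasses 𝒳 p,
        cupProduct (two_mul_add_two_mul_succ_eq hpq) a (fiberGysin hf t q b) = 0) →
        fiberGysin hf t q b = 0

/-- **`PrimE[2n]` from rank-one invariants below the middle and the single clause `A_n(𝒳, K)` at the `E`-power points** of the
compact pencils of abelian `2n`-folds (`K` any Kähler–rational datum of the total space polarising the fibres). [cite: Grothendieck1968, §3 p. 196]
[cite: vanGeemen1994HodgeAV, Thm. 4.3 and 6.12] -/
theorem primitiveLiftE_of_rankOne_below_of_lefschetzDegree_middle {n : ℕ} (hn : 1 ≤ n)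
    (h : ∀ ⦃𝒳 S : SchemeOver ℂ⦄ (f : 𝒳 ⟶ S) (_ : IsCompactAbelianPencil f (2 * n)) (t : ComplexPoints S),
      t ∈ cmPowerLocus f (2 * n) →
      (∀ r, 2 ≤ r → r < n → Module.finrank ℂ (LinearMap.range (complexBetti.map (fiberι f t) (2 * r)).hom) = 1) ∧
      ∀ D : KaehlerRationalDatum (2 * n + 1) 𝒳,
        (∀ s : ComplexPoints S, IsPolarizationClass (2 * n) (fiberOver f s) (complexBetti.map (fiberι f s) 2 D.Hη)) →
        ∀ y ∈ algebraicClasses 𝒳 (n + 1), ∃ x ∈ algebraicClasses 𝒳 n,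
          lefschetzPowTo D.Hη 1 (2 * n) (2 * (n + 1)) (by omega) x = y) :
    PrimE'[2 * n] := by
  intro 𝒳 S f hf t ht K hKalg hKs r h2r hrd ξ hξ hP hI
  obtain ⟨h1, hA⟩ := h f hf t ht
  obtain ⟨D, hD⟩ := exists_kaehlerRationalDatum_polarization_fibres hf (by omega)
  have hlift := forall_comap_le_sup_of_rankOne_below_of_lefschetzDegree_middle hf t D (fun s ↦ (hD s).hasHardLefschetz)
    (hD t) h1 (hA D hD)
  exact (forall_comap_le_sup_iff_primitiveLift hf t hKalg hKs).1 hlift r h2r hrd ξ hξ hP hI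

/-- **R∞: `WeilClassesImaginaryQuadratic` from the habitats `(W_E)ₙ` and, at the `E`-power points of the compact pencils of abelian
`2n`-folds (`n ≥ 2`), rank-one invariants below the middle together with the single clause `L_K : Nⁿ(𝒳) → N^{n+1}(𝒳)` onto** —
through `PrimE ⟹ NumE` (part XXI-b) and part XIX-f's R∞ row. `HC_CM` IDLE; no named fact; the habitats are OPEN nodes (part IX).
research route, not a corollary; conditional on HC_CM plus one named minimal statement. [cite: Grothendieck1968, §3 p. 196 (A(X))]
[cite: Andre1996Motifs, Lemme 6.3.3 (p. 33)] [cite: vanGeemen1994HodgeAV, Thm. 4.3, 5.12 and 6.12] -/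
theorem weilClassesImaginaryQuadratic_of_cmPowerWeilPencils_of_rankOne_below_of_lefschetzDegree_middle
    (hW : ∀ n, 2 ≤ n → CMPowerAnchoredCompactWeilPencilsAt n)
    (h : ∀ n, 2 ≤ n → ∀ ⦃𝒳 S : SchemeOver ℂ⦄ (f : 𝒳 ⟶ S) (_ : IsCompactAbelianPencil f (2 * n)) (t : ComplexPoints S),
      t ∈ cmPowerLocus f (2 * n) →
      (∀ r, 2 ≤ r → r < n → Module.finrank ℂ (LinearMap.range (complexBetti.map (fiberι f t) (2 * r)).hom) = 1) ∧
      ∀ D : KaehlerRationalDatum (2 * n + 1) 𝒳,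
        (∀ s : ComplexPoints S, IsPolarizationClass (2 * n) (fiberOver f s) (complexBetti.map (fiberι f s) 2 D.Hη)) →
        ∀ y ∈ algebraicClasses 𝒳 (n + 1), ∃ x ∈ algebraicClasses 𝒳 n,
          lefschetzPowTo D.Hη 1 (2 * n) (2 * (n + 1)) (by omega) x = y) :
    WeilClassesImaginaryQuadratic :=
  weilClassesImaginaryQuadratic_of_cmPowerWeilPencils_of_numerical hW fun n hn ↦
    numericalE_of_primitiveLiftE (primitiveLiftE_of_rankOne_below_of_lefschetzDegree_middle (by omega) (h n hn)) n n

end Middle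

end Summit.HodgeConjecture.HodgeConjecture.Ring2.AbelianAll

end
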